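import Literature.Analysis.FluidPDE.Tao2016AveragedNS.ReachRadiusLine
import HarnessLib

/-!
# Scale covariance of the reach interface: the tolerance law of Tao's gate is EXACTLY level-independent

**Honest framing.** low prior, high value-of-information experiment on Tao's machine paradigm; NOT a
claim that NS blows up. This file is Literature-side bookkeeping for the cell `pub-fluidc`: it
records, in bp3's typed `ReachCertificate` interface, the rescaling covariance that
[cite: Tao2016AveragedNS, Remark 6.1] uses to run the same gate at every level of the cascade —
every gate (5.5) is a homogeneous QUADRATIC field, `F(c • X) = c² • F(X)`, so `t ↦ c • x(ct)`
solves the same equation — and its consequence for the certifiable radius of `ReachRadiusLine.lean`.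
Nothing here is a statement about the Navier–Stokes equations.

**What is new.** `ReachScaling.lean` / `ReachConeWide.lean` / `ReachRadiusLine.lean` built the
level-`c₀` certificates by hand and found the SAME bracket at every level in the
level-one-equivalent forcing `ε_d/c₀²` (to `1.35 %`). Here the level dependence is removed exactly:

* §1 (any real normed space `O`, any field `F` with `F(c • X) = c² • F(X)`, any regions):
  **`certificateRescale`** — a reach certificate for `(U, ε, τc, Ain, Aout)` IS a reach certificate
  for `(c • U, c²ε, τc/c, c • Ain, c • Aout)`, `c > 0`, with tube `c • Tube (c⁻¹ • p) (cσ)`: the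
  interface is scale covariant for quadratic designs (usable verbatim for bp3's `thresholdCircuit`,
  which is quadratic too); `certificateOfLe` — a certificate tolerating defect `ε` tolerates every
  `ε' ≤ ε`; `certificateCast` — transport along parameter identities.
* §2 (Tao's member): `smul_coneFrom` (`c • coneFrom c₀ A = coneFrom (c c₀) A`),
  **`taoReachCone_rescale`** (level `c₀`, defect `ε_d`, cycle `2/c₀` ↦ level `c c₀`, defect
  `c²ε_d`, cycle `2/(c c₀)`), **`nonempty_taoReachCone_iff_level`** (certifiability at level `c₀`
  with forcing `ε_d` ⟺ at level `1` with forcing `ε_d/c₀²`).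
* §3 THE LEVEL-FREE LAW: **`reachRadiusCone_level`**:
  `reachRadiusCone K M ε c₀ ε_d = reachRadiusCone K M ε 1 (ε_d/c₀²)` — ONE function `R₁` of ONE
  variable gives the certifiable relative radius at every level, exactly (the `1.35 %` bracket of
  `ReachRadiusLine.lean` is a statement about `R₁` alone); `reachRadiusCone_rescale`;
  monotonicity: `reachRadiusCone_anti` (more forcing, smaller radius), `reachRadius_anti`,
  **`reachRadiusCone_mono_level`** (at fixed absolute forcing louder stages tolerate more).

**What is NOT claimed.** The value of `R₁` inside its bracket; covariance for non-homogeneous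
designs (a viscous member is NOT covariant — dissipation breaks the scaling, which is the whole
point of Tao's supercriticality bookkeeping and is not modelled here); anything fluid-side.
-/

noncomputable section

open Real Set MeasureTheory Metric
open scoped NNReal Pointwise
open Literature.Analysis.FluidPDE.FluidComputer (ReachCertificate)

namespace Literature.Analysis.FluidPDE.Tao2016AveragedNS

/-! ## §1. Scale covariance of the reach interface for quadratic designs -/

section General

variable {O : Type*} [NormedAddCommGroup O] [NormedSpace ℝ O]
variable {F : O → O} {U : Set O} {εd τc : ℝ} {Ain Aout : Set O}

/-- Transport of a reach certificate along identities of its five parameters (bookkeeping).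
[folklore] -/
def certificateCast (C : ReachCertificate F U εd τc Ain Aout) {U' : Set O} {εd' τc' : ℝ}
    {Ain' Aout' : Set O} (hU : U = U') (hε : εd = εd') (hτ : τc = τc') (hA : Ain = Ain')
    (hB : Aout = Aout') : ReachCertificate F U' εd' τc' Ain' Aout' := by
  subst hU hε hτ hA hB
  exact C

/-- **Defect monotonicity**: a reach certificate tolerating forcing `ε_d` tolerates every
`ε_d' ≤ ε_d`, with the same tube. [folklore] -/
def certificateOfLe (C : ReachCertificate F U εd τc Ain Aout) {εd' : ℝ} (h : εd' ≤ εd) :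
    ReachCertificate F U εd' τc Ain Aout where
  Tube := C.Tube
  Tube_closed := C.Tube_closed
  Tube_zero := C.Tube_zero
  Tube_sub := C.Tube_sub
  cert p hp σT x h0 hσT hx0 hcont hU hW :=
    C.cert p hp σT x h0 hσT hx0 hcont hU fun σ hσ => by
      obtain ⟨W, hW1, hW2⟩ := hW σ hσ
      exact ⟨W, hW1, hW2.trans h⟩

/-- The tube of `certificateOfLe` is the original tube. [folklore] -/
theorem certificateOfLe_tube (C : ReachCertificate F U εd τc Ain Aout) {εd' : ℝ} (h : εd' ≤ εd)
    (p : O) (σ : ℝ) : (certificateOfLe C h).Tube p σ = C.Tube p σ := rfl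

/-- Right derivative of a time-dilated curve in a normed space: if `y` has right derivative `W`
at `a·t` then `s ↦ y (a s)` has right derivative `a • W` at `t` (`a > 0`). [folklore] -/
theorem hasDerivWithinAt_comp_mul_of_pos {y : ℝ → O} {W : O} {a t : ℝ} (ha : 0 < a)
    (hy : HasDerivWithinAt y W (Ici (a * t)) (a * t)) :
    HasDerivWithinAt (fun s => y (a * s)) (a • W) (Ici t) t := by
  have hm : HasDerivWithinAt (fun s : ℝ => a * s) a (Ici t) t := by
    simpa using (hasDerivWithinAt_id t (Ici t)).const_mul a
  have hmaps : MapsTo (fun s : ℝ => a * s) (Ici t) (Ici (a * t)) := fun s hs =>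
    mul_le_mul_of_nonneg_left hs ha.le
  exact hy.scomp t hm hmaps

/-- **SCALE COVARIANCE OF THE REACH INTERFACE (quadratic designs).** Let `F (c • X) = c² • F X`
for all `c, X` (every gate of [Tao2016AveragedNS, §5] and every superposition of them). A reach
certificate for working region `U`, defect `ε_d`, cycle time `τc`, input `Ain`, output `Aout`
yields, for every `c > 0`, a reach certificate for `c • U`, defect `c²·ε_d`, cycle time `τc/c`,
input `c • Ain`, output `c • Aout`, with tube `σ ↦ c • Tube (c⁻¹ • p) (c σ)`: an admissible curve
`y` from `c • p₀` is read as `x(s) = c⁻¹ • y(s/c)`, an admissible curve from `p₀` with defect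
`≤ ε_d` (homogeneity), to which the given certificate applies. This is the rescaling of
[cite: Tao2016AveragedNS, Remark 6.1] at the level of certificates. -/
def certificateRescale (hF : ∀ (c : ℝ) (X : O), F (c • X) = c ^ 2 • F X)
    (C : ReachCertificate F U εd τc Ain Aout) {c : ℝ} (hc : 0 < c) :
    ReachCertificate F (c • U) (c ^ 2 * εd) (τc / c) (c • Ain) (c • Aout) where
  Tube p σ := c • C.Tube (c⁻¹ • p) (c * σ)
  Tube_closed p hp := by
    obtain ⟨p₀, hp₀, rfl⟩ := Set.mem_smul_set.1 hp
    have hφ : Continuous fun z : ℝ × O => ((c * z.1, c⁻¹ • z.2) : ℝ × O) := by fun_prop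
    have hS := (C.Tube_closed p₀ hp₀).preimage hφ
    rw [inv_smul_smul₀ hc.ne']
    convert hS using 1
    ext z
    simp only [mem_setOf_eq, mem_preimage, mem_Icc]
    rw [Set.mem_smul_set_iff_inv_smul_mem₀ hc.ne']
    constructor
    · rintro ⟨⟨h0, h1⟩, h2⟩
      refine ⟨⟨mul_nonneg hc.le h0, ?_⟩, h2⟩
      rw [le_div_iff₀ hc] at h1
      linarith
    · rintro ⟨⟨h0, h1⟩, h2⟩
      refine ⟨⟨?_, ?_⟩, h2⟩
      · nlinarith
      · rw [le_div_iff₀ hc]; linarith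
  Tube_zero p hp := by
    obtain ⟨p₀, hp₀, rfl⟩ := Set.mem_smul_set.1 hp
    rw [inv_smul_smul₀ hc.ne', mul_zero]
    exact Set.smul_mem_smul_set (C.Tube_zero p₀ hp₀)
  Tube_sub p hp σ hσ := by
    obtain ⟨p₀, hp₀, rfl⟩ := Set.mem_smul_set.1 hp
    rw [inv_smul_smul₀ hc.ne']
    refine Set.smul_set_mono (C.Tube_sub p₀ hp₀ (c * σ) ⟨mul_nonneg hc.le hσ.1, ?_⟩)
    have := hσ.2
    rw [le_div_iff₀ hc] at this
    linarith
  cert p hp σT y h0 hσT hy0 hcont hyU hW := by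
    obtain ⟨p₀, hp₀, rfl⟩ := Set.mem_smul_set.1 hp
    have hc0 : c ≠ 0 := hc.ne'
    have hci : 0 < c⁻¹ := inv_pos.2 hc
    have hcσT : c * σT ≤ τc := by
      have := hσT; rw [le_div_iff₀ hc] at this; linarith
    -- the rescaled curve
    set x : ℝ → O := fun s => c⁻¹ • y (c⁻¹ * s) with hx
    have hx0 : x 0 = p₀ := by
      simp only [hx, mul_zero, hy0, inv_smul_smul₀ hc0]
    have hIco : ∀ s ∈ Ico 0 (c * σT), c⁻¹ * s ∈ Ico 0 σT := by
      intro s hs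
      refine ⟨mul_nonneg hci.le hs.1, ?_⟩
      have := mul_lt_mul_of_pos_left hs.2 hci
      rwa [← mul_assoc, inv_mul_cancel₀ hc0, one_mul] at this
    have hmaps : MapsTo (fun s : ℝ => c⁻¹ * s) (Icc 0 (c * σT)) (Icc 0 σT) := by
      intro s hs
      refine ⟨mul_nonneg hci.le hs.1, ?_⟩
      have := mul_le_mul_of_nonneg_left hs.2 hci.le
      rwa [← mul_assoc, inv_mul_cancel₀ hc0, one_mul] at this
    have hcont' : ContinuousOn x (Icc 0 (c * σT)) :=
      ((hcont.comp (continuous_const_mul c⁻¹).continuousOn hmaps)).const_smul c⁻¹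
    have hU' : ∀ s ∈ Ico 0 (c * σT), x s ∈ U := by
      intro s hs
      have := hyU (c⁻¹ * s) (hIco s hs)
      rwa [Set.mem_smul_set_iff_inv_smul_mem₀ hc0] at this
    have hW' : ∀ s ∈ Ico 0 (c * σT), ∃ W : O, HasDerivWithinAt x W (Ici s) s ∧
        ‖W - F (x s)‖ ≤ εd := by
      intro s hs
      obtain ⟨W, hW1, hW2⟩ := hW (c⁻¹ * s) (hIco s hs)
      refine ⟨c⁻¹ • (c⁻¹ • W), (hasDerivWithinAt_comp_mul_of_pos hci hW1).const_smul c⁻¹, ?_⟩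
      have hFx : F (x s) = c⁻¹ ^ 2 • F (y (c⁻¹ * s)) := by
        simp only [hx]; rw [hF]
      rw [hFx, smul_smul, ← pow_two, ← smul_sub, norm_smul, norm_pow, Real.norm_eq_abs,
        abs_of_pos hci]
      calc c⁻¹ ^ 2 * ‖W - F (y (c⁻¹ * s))‖ ≤ c⁻¹ ^ 2 * (c ^ 2 * εd) :=
            mul_le_mul_of_nonneg_left hW2 (by positivity)
        _ = εd := by field_simp
    obtain ⟨h1, h2⟩ := C.cert p₀ hp₀ (c * σT) x (by positivity) hcσT hx0 hcont' hU' hW'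
    refine ⟨?_, fun hτ => ?_⟩
    · rw [inv_smul_smul₀ hc0, Set.mem_smul_set_iff_inv_smul_mem₀ hc0]
      have hxe : x (c * σT) = c⁻¹ • y σT := by
        simp only [hx]; rw [← mul_assoc, inv_mul_cancel₀ hc0, one_mul]
      rwa [hxe] at h1
    · have hcτ : c * σT = τc := by rw [hτ]; field_simp
      obtain ⟨s, hs, hsA⟩ := h2 hcτ
      refine ⟨c⁻¹ * s, ⟨mul_nonneg hci.le hs.1, ?_⟩, ?_⟩
      · rw [le_div_iff₀ hc, mul_comm, ← mul_assoc, mul_inv_cancel₀ hc0, one_mul]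
        exact hs.2
      · have hys : y (c⁻¹ * s) = c • x s := by
          simp only [hx]; rw [smul_inv_smul₀ hc0]
        rw [hys]
        exact Set.smul_mem_smul_set hsA

/-- The tube of the rescaled certificate. [folklore] -/
theorem certificateRescale_tube (hF : ∀ (c : ℝ) (X : O), F (c • X) = c ^ 2 • F X)
    (C : ReachCertificate F U εd τc Ain Aout) {c : ℝ} (hc : 0 < c) (p : O) (σ : ℝ) :
    (certificateRescale hF C hc).Tube p σ = c • C.Tube (c⁻¹ • p) (c * σ) := rfl

/-- **Certifiability is scale covariant** (quadratic designs): for `c > 0` the interface for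
`(U, ε_d, τc, Ain, Aout)` is inhabited iff the one for `(c • U, c²ε_d, τc/c, c • Ain, c • Aout)`
is. [cite: Tao2016AveragedNS, Remark 6.1] -/
theorem nonempty_reachCertificate_iff_smul (hF : ∀ (c : ℝ) (X : O), F (c • X) = c ^ 2 • F X)
    {c : ℝ} (hc : 0 < c) :
    Nonempty (ReachCertificate F U εd τc Ain Aout) ↔
      Nonempty (ReachCertificate F (c • U) (c ^ 2 * εd) (τc / c) (c • Ain) (c • Aout)) := by
  have hc0 : c ≠ 0 := hc.ne'
  refine ⟨fun ⟨C⟩ => ⟨certificateRescale hF C hc⟩, fun ⟨C⟩ => ⟨?_⟩⟩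
  refine certificateCast (certificateRescale hF C (inv_pos.2 hc)) ?_ ?_ ?_ ?_ ?_
  · rw [smul_smul, inv_mul_cancel₀ hc0, one_smul]
  · field_simp
  · field_simp
  · rw [smul_smul, inv_mul_cancel₀ hc0, one_smul]
  · rw [smul_smul, inv_mul_cancel₀ hc0, one_smul]

end General

/-! ## §2. Tao's member: the cone certificates move between levels exactly -/

/-- Scaling a cone moves its level: `c • coneFrom c₀ A = coneFrom (c·c₀) A` (`c > 0`). [folklore] -/
theorem smul_coneFrom {c c₀ : ℝ} (hc : 0 < c) (A : Set (Fin 5 → ℝ)) :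
    c • coneFrom c₀ A = coneFrom (c * c₀) A := by
  ext p
  rw [Set.mem_smul_set]
  constructor
  · rintro ⟨q, ⟨d, hd, a, ha, rfl⟩, rfl⟩
    exact ⟨c * d, mul_le_mul_of_nonneg_left hd hc.le, a, ha, by rw [smul_smul]⟩
  · rintro ⟨d, hd, a, ha, rfl⟩
    refine ⟨(c⁻¹ * d) • a, ⟨c⁻¹ * d, ?_, a, ha, rfl⟩, ?_⟩
    · rw [le_inv_mul_iff₀ hc]; exact hd
    · rw [smul_smul, ← mul_assoc, mul_inv_cancel₀ hc.ne', one_mul]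

/-- The whole phase space is scale invariant. [folklore] -/
theorem smul_univ_fin5 {c : ℝ} (hc : c ≠ 0) : c • (univ : Set (Fin 5 → ℝ)) = univ :=
  Set.smul_set_univ₀ hc

/-- **Level transport of the cone certificates of Tao's gate**: a certificate at level `c₀ > 0`
(defect `ε_d`, cycle time `2/c₀`, classes `coneFrom c₀ A → coneFrom c₀ B`, `U = univ`) yields one at
level `c·c₀` with defect `c²·ε_d` and cycle time `2/(c c₀)`, every `c > 0` — the rescaling of
[cite: Tao2016AveragedNS, Remark 6.1], now for certificates rather than for hand-built tubes
(`reachCertificateCone`). -/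
def taoReachCone_rescale {K M ε c₀ εd c : ℝ} {A B : Set (Fin 5 → ℝ)} (hc : 0 < c)
    (C : ReachCertificate (delayCircuitWith K M ε) (univ : Set (Fin 5 → ℝ)) εd (2 / c₀)
      (coneFrom c₀ A) (coneFrom c₀ B)) :
    ReachCertificate (delayCircuitWith K M ε) (univ : Set (Fin 5 → ℝ)) (c ^ 2 * εd) (2 / (c * c₀))
      (coneFrom (c * c₀) A) (coneFrom (c * c₀) B) :=
  certificateCast (certificateRescale (delayCircuitWith_smul K M ε) C hc) (smul_univ_fin5 hc.ne') rfl
    (by rw [div_div, mul_comm]) (smul_coneFrom hc A) (smul_coneFrom hc B)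

/-- **Certifiability at level `c₀` with forcing `ε_d` ⟺ certifiability at level `1` with forcing
`ε_d/c₀²`** (cone classes over the same base sets, cycle times `2/c₀` and `2/1`): the forcing
"heard at level one" is `ε_d/c₀²`, exactly. [cite: Tao2016AveragedNS, Remark 6.1] -/
theorem nonempty_taoReachCone_iff_level {K M ε c₀ εd : ℝ} {A B : Set (Fin 5 → ℝ)} (hc₀ : 0 < c₀) :
    Nonempty (ReachCertificate (delayCircuitWith K M ε) (univ : Set (Fin 5 → ℝ)) εd (2 / c₀)
        (coneFrom c₀ A) (coneFrom c₀ B)) ↔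
      Nonempty (ReachCertificate (delayCircuitWith K M ε) (univ : Set (Fin 5 → ℝ)) (εd / c₀ ^ 2)
        (2 / 1) (coneFrom 1 A) (coneFrom 1 B)) := by
  have hc0 : c₀ ≠ 0 := hc₀.ne'
  constructor
  · rintro ⟨C⟩
    refine ⟨certificateCast (taoReachCone_rescale (inv_pos.2 hc₀) C) rfl ?_ ?_ ?_ ?_⟩
    · field_simp
    · rw [inv_mul_cancel₀ hc0]
    · rw [inv_mul_cancel₀ hc0]
    · rw [inv_mul_cancel₀ hc0]
  · rintro ⟨C⟩
    refine ⟨certificateCast (taoReachCone_rescale hc₀ C) rfl ?_ ?_ ?_ ?_⟩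
    · field_simp
    · rw [mul_one]
    · rw [mul_one]
    · rw [mul_one]

/-! ## §3. The level-free law of the certifiable radius -/

/-- **THE TOLERANCE LAW OF TAO'S GATE IS EXACTLY LEVEL-INDEPENDENT**: for every member, every
level `c₀ > 0` and every forcing level `ε_d`,
`reachRadiusCone K M ε c₀ ε_d = reachRadiusCone K M ε 1 (ε_d/c₀²)` — ONE function of ONE variable
(the level-one radius law `R₁`) evaluated at the level-one-equivalent forcing `ε_d/c₀²`. The
two-sided `1.35 %` bracket of `ReachRadiusLine.lean` is a statement about `R₁`.
[cite: Tao2016AveragedNS, §5.5 Theorem 5.3, Remark 6.1] -/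
theorem reachRadiusCone_level {K M ε c₀ : ℝ} (hc₀ : 0 < c₀) (εd : ℝ) :
    reachRadiusCone K M ε c₀ εd = reachRadiusCone K M ε 1 (εd / c₀ ^ 2) := by
  simp only [reachRadiusCone]
  congr 1
  ext ρ
  exact nonempty_taoReachCone_iff_level hc₀

/-- The same law between two arbitrary levels: `reachRadiusCone K M ε (c·c₀) (c²·ε_d) =
reachRadiusCone K M ε c₀ ε_d` (`c, c₀ > 0`). [cite: Tao2016AveragedNS, Remark 6.1] -/
theorem reachRadiusCone_rescale {K M ε c₀ c : ℝ} (hc₀ : 0 < c₀) (hc : 0 < c) (εd : ℝ) :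
    reachRadiusCone K M ε (c * c₀) (c ^ 2 * εd) = reachRadiusCone K M ε c₀ εd := by
  rw [reachRadiusCone_level (mul_pos hc hc₀), reachRadiusCone_level hc₀]
  congr 1
  field_simp

/-- Defect monotonicity of certifiability of the cone classes. [folklore] -/
theorem nonempty_taoReachCone_of_le {K M ε c₀ εd εd' ρ : ℝ} (h : εd' ≤ εd)
    (hne : Nonempty (ReachCertificate (delayCircuitWith K M ε) (univ : Set (Fin 5 → ℝ)) εd (2 / c₀)
      (coneFrom c₀ (closedBall delayInit ρ)) (coneFrom c₀ (firedSet K 6 4)))) :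
    Nonempty (ReachCertificate (delayCircuitWith K M ε) (univ : Set (Fin 5 → ℝ)) εd' (2 / c₀)
      (coneFrom c₀ (closedBall delayInit ρ)) (coneFrom c₀ (firedSet K 6 4))) :=
  ⟨certificateOfLe hne.some h⟩

/-- Defect monotonicity of certifiability of the level-one ball classes. [folklore] -/
theorem nonempty_taoReach_of_le {K M ε εd εd' ρ : ℝ} (h : εd' ≤ εd)
    (hne : Nonempty (ReachCertificate (delayCircuitWith K M ε) (ball (0 : Fin 5 → ℝ) 2) εd 2
      (closedBall delayInit ρ) (firedSet K 6 4))) :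
    Nonempty (ReachCertificate (delayCircuitWith K M ε) (ball (0 : Fin 5 → ℝ) 2) εd' 2
      (closedBall delayInit ρ) (firedSet K 6 4)) :=
  ⟨certificateOfLe hne.some h⟩

section StandingCovariance

variable {K M ε : ℝ} (hK : 2 * 20 ^ 42 * (Nat.factorial 42 : ℝ) + 16 ≤ K)
  (hML : 3000 * Real.log K ≤ M) (hMK : M ≤ K ^ 10) (hε : 0 < ε)
  (hεle : ε ≤ exp (-(10 * M)) / K ^ 100)
include hK hML hMK hε hεle

/-- **More forcing, smaller radius**: `reachRadiusCone K M ε c₀ ·` is antitone on `[0, ∞)`.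
[cite: Tao2016AveragedNS, §5.5 Theorem 5.3] -/
theorem reachRadiusCone_anti {c₀ εd εd' : ℝ} (hc₀ : 0 < c₀) (hεd : 0 ≤ εd) (h : εd ≤ εd') :
    reachRadiusCone K M ε c₀ εd' ≤ reachRadiusCone K M ε c₀ εd :=
  csSup_le_csSup (bddAbove_reachRadiiCone hK hML hMK hε hεle hc₀ hεd)
    ⟨-1, nonempty_taoReachCone_of_neg (by norm_num)⟩ fun _ hρ => nonempty_taoReachCone_of_le h hρ

/-- **More forcing, smaller radius** (level one, ball classes): `reachRadius K M ε ·` is antitone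
on `[0, ∞)`. [cite: Tao2016AveragedNS, §5.5 Theorem 5.3] -/
theorem reachRadius_anti {εd εd' : ℝ} (hεd : 0 ≤ εd) (h : εd ≤ εd') :
    reachRadius K M ε εd' ≤ reachRadius K M ε εd :=
  csSup_le_csSup (bddAbove_reachRadii hK hML hMK hε hεle hεd)
    ⟨-1, nonempty_taoReach_of_neg (by norm_num)⟩ fun _ hρ => nonempty_taoReach_of_le h hρ

/-- **At fixed absolute forcing, louder stages tolerate more**: for `0 < c₀ ≤ c₁` and `ε_d ≥ 0`,
`reachRadiusCone K M ε c₀ ε_d ≤ reachRadiusCone K M ε c₁ ε_d` (the forcing heard at level one,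
`ε_d/c²`, decreases with the level). [cite: Tao2016AveragedNS, §5.5 Theorem 5.3, Remark 6.1] -/
theorem reachRadiusCone_mono_level {c₀ c₁ εd : ℝ} (hc₀ : 0 < c₀) (h : c₀ ≤ c₁) (hεd : 0 ≤ εd) :
    reachRadiusCone K M ε c₀ εd ≤ reachRadiusCone K M ε c₁ εd := by
  have hc₁ : 0 < c₁ := lt_of_lt_of_le hc₀ h
  rw [reachRadiusCone_level hc₀, reachRadiusCone_level hc₁]
  refine reachRadiusCone_anti hK hML hMK hε hεle one_pos (by positivity) ?_
  exact div_le_div_of_nonneg_left hεd (by positivity) (pow_le_pow_left₀ hc₀.le h 2)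

/-- **The level-free law with its bracket, in one statement**: at every level `c₀ > 0` the
certifiable relative radius is `R₁(ε_d/c₀²)` with `R₁ := reachRadiusCone K M ε 1`, and
`1.2532u - 1.27η/√M ≤ R₁(η) ≤ 1.2535u - 1.2535η/√M` for `0 ≤ η`, `1.27η/√M < 1.2532u`
(`u = ε²e^{-M}/√M`), `R₁(η) = 0` for `η ≥ ε²e^{-M}`.
[cite: Tao2016AveragedNS, §5.5 Theorem 5.3, Remark 6.1] -/
theorem reachRadiusCone_law {c₀ εd : ℝ} (hc₀ : 0 < c₀) (hεd : 0 ≤ εd) :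
    reachRadiusCone K M ε c₀ εd = reachRadiusCone K M ε 1 (εd / c₀ ^ 2) ∧
      (127 / 100 * (εd / c₀ ^ 2) / Real.sqrt M < 3133 / 2500 * (ε ^ 2 * exp (-M)) / Real.sqrt M →
        reachRadiusCone K M ε 1 (εd / c₀ ^ 2) ∈
          Icc (3133 / 2500 * (ε ^ 2 * exp (-M)) / Real.sqrt M - 127 / 100 * (εd / c₀ ^ 2) / Real.sqrt M)
            (2507 / 2000 * (ε ^ 2 * exp (-M)) / Real.sqrt M -
              2507 / 2000 * (εd / c₀ ^ 2) / Real.sqrt M)) ∧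
      (ε ^ 2 * exp (-M) ≤ εd / c₀ ^ 2 → reachRadiusCone K M ε 1 (εd / c₀ ^ 2) = 0) := by
  refine ⟨reachRadiusCone_level hc₀ εd, fun hWd => ?_, fun h => ?_⟩
  · rw [← reachRadiusCone_level hc₀]
    exact reachRadiusCone_mem_Icc_line hK hML hMK hε hεle hc₀ hεd hWd
  · have hK2 : (2 : ℝ) ≤ K := by linarith [(negKick_params hK hML hMK hε hεle).1]
    exact reachRadiusCone_eq_zero_of_sq_mul_seed_le hK2 one_pos (by simpa using h)

end StandingCovariance

end Literature.Analysis.FluidPDE.Tao2016AveragedNS
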